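import Mathlib
import HarnessLib
import Summits.RiemannHypothesis.RiemannHypothesis.Theses.WeilParity

/-! VERBATIM rev-1 text of `GroundBarta.EvenWinsBeyondArch` (tree file lines 323-324, copied by script),
re-elaborated HERE from source (independent of the farm's olean for the GroundBarta module, which RevProbe.lean
shows is STALE = rev 0), and compared by `Iff.rfl` with `WeilParity.EvenWinsBeyondArch`. -/

namespace Summit.RiemannHypothesis.RiemannHypothesis.Cruxes.EvenWinsBeyondArch.GroundBartaRev1Verbatim

set_option linter.dupNamespace false

open scoped BigOperators Topology Manifold Classical MeasureTheory ProbabilityTheory Matrix InnerProductSpace ComplexConjugate ContinuousMap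
open Filter Set Function TopologicalSpace MeasureTheory

def EvenWinsBeyondArchRev1 : Prop :=
  let C : (ℝ → ℂ) → ℝ → ℂ := fun g => MeasureTheory.convolution g (fun t => (starRingEnd ℂ) (g (-t))) (ContinuousLinearMap.mul ℂ ℂ) MeasureTheory.MeasureSpace.volume; let M : (ℝ → ℂ) → ℂ → ℂ := fun F s => ∫ t : ℝ, F t * Complex.exp ((s - 1 / 2) * t); let Q : (ℝ → ℂ) → ℂ := fun g => M (C g) 0 + M (C g) 1 - (∑' n : ℕ, ((ArithmeticFunction.vonMangoldt n : ℝ) : ℂ) / (Real.sqrt n : ℂ) * (C g (Real.log n) + C g (-Real.log n))) + ((1 / (2 * Real.pi) : ℂ) * (∫ t : ℝ, M (C g) (1 / 2 + t * Complex.I) * ((Complex.digamma (1 / 4 + t / 2 * Complex.I)).re : ℂ)) - C g 0 * (Real.log Real.pi : ℂ)); ∀ a : ℝ, Real.log 2 / 2 < a → ∀ o : ℝ → ℂ, (ContDiff ℝ ((⊤ : ℕ∞) : WithTop ℕ∞) o ∧ HasCompactSupport o) → tsupport o ⊆ Set.Icc (-a) a → (∀ t, o (-t) = -o t) → ∫ t,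 ‖o t‖ ^ 2 = (1 : ℝ) → ∀ δ : ℝ, 0 < δ → ∃ e : ℝ → ℂ, (ContDiff ℝ ((⊤ : ℕ∞) : WithTop ℕ∞) e ∧ HasCompactSupport e) ∧ tsupport e ⊆ Set.Icc (-a) a ∧ (∀ t, e (-t) = e t) ∧ ∫ t, ‖e t‖ ^ 2 = (1 : ℝ) ∧ (Q e).re ≤ (Q o).re + δ

/-- THE REAL DEFEQ CERTIFICATE for the rev-1 inline dictionary. -/
theorem rev1_iff_weilParity :
    EvenWinsBeyondArchRev1 ↔ Summit.RiemannHypothesis.RiemannHypothesis.Theses.WeilParity.EvenWinsBeyondArch :=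
  Iff.rfl

/-- and the inline `Q` is token-for-token `weilQuadratic` (pointwise defeq of the dictionary). -/
example (g : ℝ → ℂ) :
    (let C : (ℝ → ℂ) → ℝ → ℂ := fun g => MeasureTheory.convolution g (fun t => (starRingEnd ℂ) (g (-t))) (ContinuousLinearMap.mul ℂ ℂ) MeasureTheory.MeasureSpace.volume; let M : (ℝ → ℂ) → ℂ → ℂ := fun F s => ∫ t : ℝ, F t * Complex.exp ((s - 1 / 2) * t); let Q : (ℝ → ℂ) → ℂ := fun g => M (C g) 0 + M (C g) 1 - (∑' n : ℕ, ((ArithmeticFunction.vonMangoldt n : ℝ) : ℂ) / (Real.sqrt n : ℂ) * (C g (Real.log n) + C g (-Real.log n))) + ((1 / (2 * Real.pi) : ℂ) * (∫ t : ℝ, M (C g) (1 / 2 + t * Complex.I) * ((Complex.digamma (1 / 4 + t / 2 * Complex.I)).re : ℂ)) - C g 0 * (Real.log Real.pi : ℂ)); Q g)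
      = Literature.NumberTheory.LFunctions.weilQuadratic g := rfl

example (g : ℝ → ℂ) : (ContDiff ℝ ((⊤ : ℕ∞) : WithTop ℕ∞) g ∧ HasCompactSupport g) =
    Literature.NumberTheory.LFunctions.IsWeilTest g := rfl

end Summit.RiemannHypothesis.RiemannHypothesis.Cruxes.EvenWinsBeyondArch.GroundBartaRev1Verbatim
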